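import Summits.ABC.IUTFork.Cor312NegLogThetaUpperPrVolLocal
import Summits.ABC.IUTFork.Cor312VolumesPadicLatticeScaledBlocks
import Mathlib.Data.Int.Log
import HarnessLib

/-!
# [IUTchIII] Cor. 3.12 — per-TUPLE genuine-glue UPPER BOUNDS on the Θ-side local terms `−|log(Θ)|_{j,p}` at the
# print-normalised assembled real setting `Real.settingPrVol` / `Real.settingPrVolSharp`, ANY prime, ramified included

PROOF-ONLY support piece of the abc-iut cell (R2 S-chain team, seat abc-iut-s2-p6, TARGET #2 `hΘ` of
`Conditional/AbcOfSGenuine.lean` v3; F-side half). TAKES NO SIDE on [IUTchIII] Cor. 3.12; theorems only, 0 `def`s, no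
new `Prop` fact, no instance. S. Mochizuki, *Inter-universal Teichmüller theory III*, Cor. 3.12 (kurims May-2020 ms
pp. 173–175): the Θ-side quantity is "the procession-normalized mono-analytic log-volume of the holomorphic hull of the
union of the possible images of a Θ-pilot object … subject to the indeterminacies (Ind1), (Ind2), (Ind3)" —
abc-iut-c312-7's `Cor312.Setting.thetaLocal` / `negLogTheta`.

abc-iut-w4-d107's `Cor312NegLogThetaUpperPrVolLocal` (p432064) bounds `−|log(Θ)|_{i+1,p}` at `Real.settingPrVol` by
`log(p²·R·ρ/r)` for ONE radius `ρ` enclosing every Θ-box coordinate of the packet — so at a prime of bad mass `< 1`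
(some place of `F` over `p` outside `S`) the unit coordinates force `ρ ≥ 1` and the Θ-gain is lost. THIS FILE is the
per-TUPLE refinement: the stable set is abc-iut-c312-5's SUMMAND-WISE scaled log-shell lattice
`e⁻¹(Π_{v⃗} c(v⃗)·I_{v⃗})` (`Cor312VolumesPadicLatticeScaled`: `latticePkS`, fixed by every (Ind1)/(Ind2)-family as soon
as `c` is capsule-symmetric, `family_image_latticePkS_of_symm`), with one radius `ρ(v⃗)` per summand:

* (generic per-block membership / radii of `latticePkS`: companion `Cor312VolumesPadicLatticeScaledBlocks`);
* §1 at `Real.settingPrVol` (generic glue): `logvol_situationPrVol_preimage_hullSet_of_norm_eq` — the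
  packet-normalised volume of a hull-set preimage whose centre has block-constant norms `ν(v⃗)` is
  `Σ_{v⃗} Pr(v⃗)·log ν(v⃗)` (Dupuy–Hilado §3.6–3.7); **`thetaLocal_settingPrVol_untopD_le_of_polydiscS`** — under
  abc-iut-c312-6's `BridgeHyps`, if every Θ-box at `(i+1, p)` has its `v⃗`-block in the polydisc of radius
  `ρ(v⃗) > 0`, `ρ` capsule-symmetric, then
  `−|log(Θ)|_{i+1,p} ≤ Σ_{v⃗} Pr(v⃗)·log(p²·R·ρ(v⃗)/r) = log(p²·R/r) + Σ_{v⃗} Pr(v⃗)·log ρ(v⃗)`;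
* §2 at `Real.settingPrVolSharp` (pilot regions read off ideles `t`, `tq`):
  **`thetaLocal_settingPrVolSharp_untopD_le`** — `−|log(Θ)|_{i+1,p} ≤ log(p²·R/r) +
  Σ_{v⃗} Pr(v⃗)·log max_a ‖t_{Θ,i+1,v_a}‖`: the (Ind1)-symmetrised Θ-gain `max_a log ‖t_{Θ,i+1,v_a}‖` is KEPT on the
  tuples all of whose places carry non-unit Θ-ideles (e.g. the all-bad tuples for realising ideles, Dupuy–Hilado
  (3.4)) — exactly the exponent pattern abc-iut-c312-5 computed at an unramified prime
  (`thetaLocal_settingDHVolSharp_eq_of_zpow`: `min_a m(v_a)`), here as an upper bound at every prime.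

Sources: [IUTchIII] pp. 173–175; [IUTchIV] Thm. 1.10 Step (v) pp. 27–28 ("`−|log Θ| ≤ −min_a …`" over the tuple).
[cite: DupuyHilado2025, §3.6, §3.7, §3.9, §4.9, §4.10] [claim: Mochizuki2012, status: disputed]
HONEST FRAMING / SCOPE: (Ind2) as typed at the real setting (abc-iut-c312-5 `Real.ismDH`); the SHARP (Ind3) reading
(abc-iut-c312-3); the trivial archimedean container of the parent files. Nothing here asserts or denies [IUTchIII]
Cor. 3.12 for initial Θ-data, and nothing compares this F-level number with abc-iut-S2's `ThetaVolumeInput.negLogTheta`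
(K_{v̲}-packets; abc-iut-S3 07:44:48Z). typed ≠ proved; instantiated ≠ endorsed.
-/

noncomputable section

open Set Function
open scoped Pointwise

namespace Summit.ABC

namespace IUTFork

/-! ## §1. Per-tuple upper bounds at `Real.settingPrVol` (generic glue binders) -/

namespace Thm311

namespace Real

open Cor312 Cor312.Setting Cor312Vol Literature.IUT.LogThetaLattice Literature.IUT.LogVolume

variable {F : Type} [Field F] [NumberField F] (X : PilotData F) {logv : PadicLogs F} (hlog : LogvAnalytic logv)
  (M : Type) [Field M] [NumberField M]
  (archPk : ∀ (j : (thetaIndex X).Label) (vQ : (thetaIndex X).VQ), Set ((logShellsDH X logv).Packet j vQ))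
  (archSub : ∀ (j : (thetaIndex X).Label) (v : (thetaIndex X).V),
    Set ((logShellsDH X logv).Packet j ((thetaIndex X).over v)))
  (Ψ : ℤ → ∀ v : (thetaIndex X).V, v ∈ (thetaIndex X).Vbad → Set ((logShellsDH X logv).StarPacket v))
  (act : ℤ → ∀ v : (thetaIndex X).V, v ∈ (thetaIndex X).Vbad →
    (logShellsDH X logv).StarPacket v → Module.End ℚ ((logShellsDH X logv).StarPacket v))
  (Mmod : ℤ → ∀ j : (thetaIndex X).LabelStar, Set ((logShellsDH X logv).GlobalPacket j.1))
  (region : ℤ → ∀ j : (thetaIndex X).LabelStar, FinDivisor M → ∀ vQ : (thetaIndex X).VQ,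
    Set ((logShellsDH X logv).Packet j.1 vQ))
  (n : ℤ) {HT : Type} {LogLink : HT → HT → Type} {IsFull : ∀ {s t : HT}, LogLink s t → Prop}
  (lat : LGPGaussianLogThetaLattice LogLink IsFull)
  {Frd : Type} {IsoF : Frd → Frd → Type} {Ob : Frd → Type} {realify : Frd → Frd} {Strip : Type}
  {IsoS : Strip → Strip → Type} {Mv : ∀ v : (thetaIndex X).V, v ∈ (thetaIndex X).Vbad → Type}
  [∀ v h, Monoid (Mv v h)]
  (sig : GlobalLGPFrobenioidSignature (thetaIndex X).lstar (thetaIndex X).V (· ∈ (thetaIndex X).Vbad)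
    Frd IsoF Ob realify Strip IsoS Mv)
  (split : SplittingMonoids Mv) {ObΔ : Type} {N : ∀ v : (thetaIndex X).V, v ∈ (thetaIndex X).Vbad → Type}
  [∀ v h, Monoid (N v h)] (qData : QPilotData ObΔ N)

/-- **The packet-normalised log-volume of a hull-set preimage whose centre has BLOCK-CONSTANT norms** `‖λ_{(v⃗,i)}‖ =
ν(v⃗)` is `Σ_{v⃗} Pr(v⃗)·log ν(v⃗)` at `(j, p)` (`Σ_i e_i·f_i = D_{v⃗}` summand by summand, abc-iut-w4-d036
`sum_w_packetLogμ_factorMap_preimage_hullSet`; Dupuy–Hilado (3.7) with the probability weights of §3.6).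
[cite: DupuyHilado2025, §3.6, §3.7] -/
theorem logvol_situationPrVol_preimage_hullSet_of_norm_eq (pp : Nat.Primes) (j : (thetaIndex X).Label) :
    haveI : Fact (pp : ℕ).Prime := ⟨pp.2⟩
    ∀ (lam : ∀ s : (presAt X hlog pp).factorIdx j, (presAt X hlog pp).factorField j s)
      (ν : ((thetaIndex X).Caps j → (thetaIndex X).Fibre (.inr pp)) → ℝ),
      (∀ e, 0 < ν e) → (∀ e i, ‖lam ⟨e, i⟩‖ = ν e) →
      ((situationPrVol X hlog M archPk archSub Ψ act Mmod region).D n).logvol j (.inr pp)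
          ((fun x => (presAt X hlog pp).factorMap j x) ⁻¹' hullSet ((presAt X hlog pp).factorField j) lam) =
        ∑ e : (presAtPr X hlog pp).toLocalPieces.E j, (presAtPr X hlog pp).w j e * Real.log (ν e) := by
  haveI : Fact (pp : ℕ).Prime := ⟨pp.2⟩
  intro lam ν hν hlam
  classical
  set Pp := presAtPr X hlog pp with hPp
  have hlam_ne : ∀ s, lam s ≠ 0 := fun s => by
    obtain ⟨e, i⟩ := s
    exact norm_pos_iff.mp (by rw [hlam e i]; exact hν e)
  have hvol := Pp.sum_w_packetLogμ_factorMap_preimage_hullSet j lam hlam_ne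
  change ((situationPrVol X hlog M archPk archSub Ψ act Mmod region).D n).logvol j (.inr pp)
      ((fun x => Pp.factorMap j x) ⁻¹' hullSet (Pp.factorField j) lam) = _ at hvol
  change ((situationPrVol X hlog M archPk archSub Ψ act Mmod region).D n).logvol j (.inr pp)
      ((fun x => Pp.factorMap j x) ⁻¹' hullSet (Pp.factorField j) lam) = _
  rw [hvol]
  refine Finset.sum_congr rfl fun e _ => ?_
  -- replace every `log ‖λ_{(v⃗,i)}‖` by `log ν(v⃗)` (summand by summand, up to definitional unfolding)
  refine Eq.trans (b := ∑ i : DIdx (pp : ℕ) (Pp.kk e),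
    Pp.w j e * (((packetDegree (pp : ℕ) (DFac (pp : ℕ) (Pp.kk e)) : ℝ))⁻¹ *
      ((absRamificationIdx (pp : ℕ) (DFac (pp : ℕ) (Pp.kk e) i) : ℝ) *
        (residueDegree (pp : ℕ) (DFac (pp : ℕ) (Pp.kk e) i) : ℝ))) * Real.log (ν e))
    (Finset.sum_congr rfl fun i _ => congrArg (HMul.hMul _) (congrArg Real.log (hlam e i))) ?_
  rw [← Finset.sum_mul, ← Finset.mul_sum, ← Finset.mul_sum]
  -- `Σ_i e_i·f_i = D_{v⃗}` (the definition of the packet degree)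
  have hD : (∑ i : DIdx (pp : ℕ) (Pp.kk e), ((absRamificationIdx (pp : ℕ) (DFac (pp : ℕ) (Pp.kk e) i) : ℝ) *
        (residueDegree (pp : ℕ) (DFac (pp : ℕ) (Pp.kk e) i) : ℝ))) =
      (packetDegree (pp : ℕ) (DFac (pp : ℕ) (Pp.kk e)) : ℝ) := by
    simp only [packetDegree, Nat.cast_sum, Nat.cast_mul]
  have hDpos : (0 : ℝ) < (packetDegree (pp : ℕ) (DFac (pp : ℕ) (Pp.kk e)) : ℝ) := by
    exact_mod_cast packetDegree_pos (pp : ℕ) (DFac (pp : ℕ) (Pp.kk e))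
  rw [hD, inv_mul_cancel₀ hDpos.ne', mul_one]

section Generic

variable
  (thetaBox : ℤ → Ob sig.Clgp → ∀ (j : (thetaIndex X).Label) (vQ : (thetaIndex X).VQ),
    Set (∀ s : factorIdxDH X hlog j vQ, factorFieldDH X hlog j vQ s))
  (qCentre : ObΔ → ∀ (j : (thetaIndex X).Label) (vQ : (thetaIndex X).VQ),
    ∀ s : factorIdxDH X hlog j vQ, factorFieldDH X hlog j vQ s)
  (hq : ∀ j vQ s, qCentre (qPilotObject qData) j vQ s ≠ 0)
  (hfin : ∀ j : (thetaIndex X).Label, (Function.support fun vQ =>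
    ((situationPrVol X hlog M archPk archSub Ψ act Mmod region).D n).logvol j vQ
      (factorMapDH X hlog j vQ ⁻¹' hullSet (factorFieldDH X hlog j vQ) (qCentre (qPilotObject qData) j vQ))).Finite)

/-- **Per-TUPLE genuine-glue UPPER BOUND at `Real.settingPrVol`** (any prime, ramified included): under abc-iut-c312-6's
bridge hypotheses, if every Θ-box at the packet `π = (labelSucc i₀, p)` has its `v⃗`-block in the coordinate polydisc of
radius `ρ(v⃗) > 0`, for a CAPSULE-SYMMETRIC radius function `ρ`, then
`−|log(Θ)|_π ≤ Σ_{v⃗} Pr(v⃗)·log(p²·R·ρ(v⃗)/r)`, `r`/`R` an inner/outer radius of the log-shell lattice `latticeF 1`: the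
summand-wise scaled lattice packet `W = e⁻¹(Π_{v⃗} c(v⃗)·I_{v⃗})` of abc-iut-c312-5, `c(v⃗) = p^{−(⌊log_p(ρ(v⃗)/r)⌋+1)}`,
is (Ind1)/(Ind2)-STABLE (`family_image_latticePkS_of_symm`), contains the (Ind3)-region and lies in the hull-set
`e⁻¹(λ·𝒪_L)` with `‖λ_{(v⃗,i)}‖ = p^{⌊log_p(‖c(v⃗)‖·R)⌋+1} ≤ p²·R·ρ(v⃗)/r`; hence so does the holomorphic hull of the union
of ALL possible images (abc-iut-w4-d107 `thetaLocal_untopD_le_logvol_of_stable_subset`), and the volume of that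
hull-set is `Σ_{v⃗} Pr(v⃗)·log ‖λ_{v⃗}‖`. [claim: Mochizuki2012, status: disputed] [cite: DupuyHilado2025, §4.9, §4.10] -/
theorem thetaLocal_settingPrVol_untopD_le_of_polydiscS (pp : Nat.Primes) (i₀ : Fin (thetaIndex X).lstar)
    {r R : ℝ} (hr : 0 < r) (hR : 0 < R)
    (ρ : ((thetaIndex X).Caps (labelSucc i₀) → (thetaIndex X).Fibre (.inr pp)) → ℝ) (hρ : ∀ e, 0 < ρ e)
    (hρsymm : ∀ (σ : Equiv.Perm ((thetaIndex X).Caps (labelSucc i₀))) e, ρ (e ∘ ⇑σ) = ρ e)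
    (hball : haveI : Fact (pp : ℕ).Prime := ⟨pp.2⟩
      ∀ z : (∀ s : (presAt X hlog pp).factorIdx (labelSucc i₀), (presAt X hlog pp).factorField (labelSucc i₀) s),
        (∀ s, ‖z s‖ < r) → z ∈ (presAt X hlog pp).latticeF (labelSucc i₀) 1)
    (hbdd : haveI : Fact (pp : ℕ).Prime := ⟨pp.2⟩
      ∀ z ∈ (presAt X hlog pp).latticeF (labelSucc i₀) 1, ∀ s, ‖z s‖ ≤ R)
    (hΘ : haveI : Fact (pp : ℕ).Prime := ⟨pp.2⟩
      ∀ m : ℤ, ∀ z ∈ thetaBox m (thetaPilotObject sig split) (labelSucc i₀) (.inr pp),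
        ∀ (e : (thetaIndex X).Caps (labelSucc i₀) → (thetaIndex X).Fibre (.inr pp))
          (i : DIdx pp.1 ((presAt X hlog pp).kk e)), ‖z ⟨e, i⟩‖ ≤ ρ e)
    (H : BridgeHyps (settingPrVol X hlog M archPk archSub Ψ act Mmod region n lat sig split qData thetaBox qCentre hq
      hfin)) :
    haveI : Fact (pp : ℕ).Prime := ⟨pp.2⟩
    ((settingPrVol X hlog M archPk archSub Ψ act Mmod region n lat sig split qData thetaBox qCentre hq
        hfin).thetaLocal (labelSucc i₀) (.inr pp)).untopD 0 ≤
      ∑ e : (presAtPr X hlog pp).toLocalPieces.E (labelSucc i₀),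
        (presAtPr X hlog pp).w (labelSucc i₀) e * Real.log (((pp : ℕ) : ℝ) ^ 2 * R * ρ e / r) := by
  haveI : Fact (pp : ℕ).Prime := ⟨pp.2⟩
  classical
  set Pp := presAt X hlog pp with hPp
  have hp1 : (1 : ℝ) < (pp : ℕ) := by exact_mod_cast (Fact.out : (pp : ℕ).Prime).one_lt
  have hp1' : 1 < (pp : ℕ) := (Fact.out : (pp : ℕ).Prime).one_lt
  have hp0 : (0 : ℝ) < (pp : ℕ) := zero_lt_one.trans hp1
  have hpne : ((pp : ℕ) : ℚ_[pp]) ≠ 0 := by exact_mod_cast (Fact.out : (pp : ℕ).Prime).ne_zero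
  -- (1) the per-tuple scale `c(v⃗) = p^{-(k(v⃗)+1)}`, `k(v⃗) = ⌊log_p (ρ(v⃗)/r)⌋`, with `ρ(v⃗)/r < ‖c(v⃗)‖ ≤ p·ρ(v⃗)/r`
  set k : ((thetaIndex X).Caps (labelSucc i₀) → (thetaIndex X).Fibre (.inr pp)) → ℤ := fun e => Int.log (pp : ℕ) (ρ e / r)
    with hk
  set c : ((thetaIndex X).Caps (labelSucc i₀) → (thetaIndex X).Fibre (.inr pp)) → ℚ_[pp] :=
    fun e => ((pp : ℕ) : ℚ_[pp]) ^ (-(k e + 1)) with hc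
  have hcnorm : ∀ e, ‖c e‖ = ((pp : ℕ) : ℝ) ^ (k e + 1) := fun e => by
    simp only [hc]; rw [Padic.norm_p_zpow, neg_neg]
  have hcne : ∀ e, c e ≠ 0 := fun e => zpow_ne_zero _ hpne
  have hclo : ∀ e, ρ e < ‖c e‖ * r := fun e => by
    rw [hcnorm e]
    have h := Int.lt_zpow_succ_log_self hp1' (ρ e / r)
    exact (div_lt_iff₀ hr).mp (by exact_mod_cast h)
  have hchi : ∀ e, ‖c e‖ ≤ (pp : ℕ) * (ρ e / r) := fun e => by
    rw [hcnorm e, zpow_add_one₀ hp0.ne', mul_comm]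
    have h := Int.zpow_log_le_self hp1' (div_pos (hρ e) hr)
    exact mul_le_mul_of_nonneg_left (by exact_mod_cast h) hp0.le
  have hcsymm : ∀ (σ : Equiv.Perm ((thetaIndex X).Caps (labelSucc i₀))) e, c (e ∘ ⇑σ) = c e := fun σ e => by
    show ((pp : ℕ) : ℚ_[pp]) ^ (-(Int.log (pp : ℕ) (ρ (e ∘ ⇑σ) / r) + 1)) =
      ((pp : ℕ) : ℚ_[pp]) ^ (-(Int.log (pp : ℕ) (ρ e / r) + 1))
    rw [hρsymm σ e]
  -- (2) the per-tuple enclosing radius `λ(v⃗) = p^{-(k₂(v⃗)+1)}`, `‖c(v⃗)‖·R < ‖λ(v⃗)‖ ≤ p·‖c(v⃗)‖·R ≤ p²·R·ρ(v⃗)/r`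
  set k₂ : ((thetaIndex X).Caps (labelSucc i₀) → (thetaIndex X).Fibre (.inr pp)) → ℤ :=
    fun e => Int.log (pp : ℕ) (‖c e‖ * R) with hk₂
  set lam : ∀ s : Pp.factorIdx (labelSucc i₀), Pp.factorField (labelSucc i₀) s :=
    fun s => algebraMap ℚ_[pp] (Pp.factorField (labelSucc i₀) s) (((pp : ℕ) : ℚ_[pp]) ^ (-(k₂ s.1 + 1))) with hlam
  have hlam_norm : ∀ e i, ‖lam ⟨e, i⟩‖ = ((pp : ℕ) : ℝ) ^ (k₂ e + 1) := fun e i => by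
    show ‖algebraMap ℚ_[pp] (Pp.factorField (labelSucc i₀) ⟨e, i⟩) _‖ = _; rw [norm_algebraMap', Padic.norm_p_zpow, neg_neg]
  have hlam_ne : ∀ s, lam s ≠ 0 := fun s => by
    obtain ⟨e, i⟩ := s
    exact norm_pos_iff.mp (by rw [hlam_norm e i]; exact zpow_pos hp0 _)
  have hlam_lo : ∀ e i, ‖c e‖ * R < ‖lam ⟨e, i⟩‖ := fun e i => by
    rw [hlam_norm e i]
    exact_mod_cast Int.lt_zpow_succ_log_self hp1' (‖c e‖ * R)
  have hB : ∀ e, ((pp : ℕ) : ℝ) ^ (k₂ e + 1) ≤ ((pp : ℕ) : ℝ) ^ 2 * R * ρ e / r := fun e => by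
    have h := Int.zpow_log_le_self hp1' (mul_pos (norm_pos_iff.mpr (hcne e)) hR)
    calc ((pp : ℕ) : ℝ) ^ (k₂ e + 1) ≤ (pp : ℕ) * (‖c e‖ * R) := by
          rw [zpow_add_one₀ hp0.ne', mul_comm]; exact mul_le_mul_of_nonneg_left (by exact_mod_cast h) hp0.le
      _ ≤ (pp : ℕ) * ((pp : ℕ) * (ρ e / r) * R) :=
          mul_le_mul_of_nonneg_left (mul_le_mul_of_nonneg_right (hchi e) hR.le) hp0.le
      _ = ((pp : ℕ) : ℝ) ^ 2 * R * ρ e / r := by ring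
  -- (3) the stable set `W = e⁻¹(Π_{v⃗} c(v⃗)·I_{v⃗})` and the enclosing hull-set `Hs = e⁻¹(λ·𝒪_L)`
  set P := settingPrVol X hlog M archPk archSub Ψ act Mmod region n lat sig split qData thetaBox qCentre hq hfin
  set W : Set ((logShellsDH X logv).Packet (labelSucc i₀) (.inr pp)) := Pp.latticePkS (labelSucc i₀) c with hW
  set Hs : Set ((logShellsDH X logv).Packet (labelSucc i₀) (.inr pp)) :=
    (fun x => Pp.factorMap (labelSucc i₀) x) ⁻¹' hullSet (Pp.factorField (labelSucc i₀)) lam with hHs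
  have hWst : ∀ Φ ∈ (logShellsDH X logv).Ind1Family ∪ (logShellsDH X logv).Ind2Family,
      Φ (labelSucc i₀) (.inr pp) '' W = W := fun Φ hΦ => Pp.family_image_latticePkS_of_symm hΦ (labelSucc i₀) hcsymm
  have h3 : P.thetaRegion3 (labelSucc i₀) (.inr pp) ⊆ W := by
    intro x hx
    rw [Setting.thetaRegion3, Set.mem_iUnion] at hx
    obtain ⟨m, hm⟩ := hx
    have hm' : (fun s => Pp.factorMap (labelSucc i₀) x s) ∈ thetaBox m (thetaPilotObject sig split) (labelSucc i₀) (.inr pp) := hm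
    have hz : ∀ e i, ‖(fun s => Pp.factorMap (labelSucc i₀) x s) ⟨e, i⟩‖ ≤ ρ e := hΘ m _ hm'
    exact (Pp.mem_latticePkS_iff_factorMap c x).2 fun e =>
      Pp.block_mem_image_smul_logShell_of_norm_le hball (hcne e) (hρ e).le (hclo e)
        (fun s => Pp.factorMap (labelSucc i₀) x s) e (hz e)
  have hWH : W ⊆ Hs := by
    intro x hx
    have hx' := (Pp.mem_latticePkS_iff_factorMap c x).1 hx
    show (fun s => Pp.factorMap (labelSucc i₀) x s) ∈ hullSet (Pp.factorField (labelSucc i₀)) lam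
    rw [hullSet, mem_polydisc]
    rintro ⟨e, i⟩
    exact (Pp.norm_le_of_block_mem_image_smul_logShell hbdd (hcne e) (fun s => Pp.factorMap (labelSucc i₀) x s) e (hx' e)
      i).trans (hlam_lo e i).le
  have hHul : Hs ∈ (P.frame (labelSucc i₀) (.inr pp)).Hul := ⟨_, ⟨lam, hlam_ne, rfl⟩, rfl⟩
  -- (4) the volume of the enclosing hull-set is `Σ_{v⃗} Pr(v⃗)·(k₂(v⃗)+1)·log p ≤ Σ_{v⃗} Pr(v⃗)·log(p²·R·ρ(v⃗)/r)`
  refine (thetaLocal_untopD_le_logvol_of_stable_subset H i₀ (.inr pp) hWst h3 hWH hHul).trans ?_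
  have hvol := logvol_situationPrVol_preimage_hullSet_of_norm_eq X hlog M archPk archSub Ψ act Mmod region n pp (labelSucc i₀)
    lam (fun e => ((pp : ℕ) : ℝ) ^ (k₂ e + 1)) (fun e => zpow_pos hp0 _) hlam_norm
  change ((situationPrVol X hlog M archPk archSub Ψ act Mmod region).D n).logvol (labelSucc i₀) (.inr pp) Hs = _ at hvol
  change ((situationPrVol X hlog M archPk archSub Ψ act Mmod region).D n).logvol (labelSucc i₀) (.inr pp) Hs ≤ _
  rw [hvol]
  exact Finset.sum_le_sum fun e _ =>
    mul_le_mul_of_nonneg_left (Real.log_le_log (zpow_pos hp0 _) (hB e)) ((presAtPr X hlog pp).w_nonneg (labelSucc i₀) e)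

/-- The same bound in the form `log(p²·R/r) + Σ_{v⃗} Pr(v⃗)·log ρ(v⃗)` (the probability weights sum to `1`,
Dupuy–Hilado §3.6; abc-iut-w4-d107 `sum_w_presAtPr`). [claim: Mochizuki2012, status: disputed]
[cite: DupuyHilado2025, §3.6, §4.10] -/
theorem thetaLocal_settingPrVol_untopD_le_add_sum_log (pp : Nat.Primes) (i₀ : Fin (thetaIndex X).lstar)
    {r R : ℝ} (hr : 0 < r) (hR : 0 < R)
    (ρ : ((thetaIndex X).Caps (labelSucc i₀) → (thetaIndex X).Fibre (.inr pp)) → ℝ) (hρ : ∀ e, 0 < ρ e)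
    (hρsymm : ∀ (σ : Equiv.Perm ((thetaIndex X).Caps (labelSucc i₀))) e, ρ (e ∘ ⇑σ) = ρ e)
    (hball : haveI : Fact (pp : ℕ).Prime := ⟨pp.2⟩
      ∀ z : (∀ s : (presAt X hlog pp).factorIdx (labelSucc i₀), (presAt X hlog pp).factorField (labelSucc i₀) s),
        (∀ s, ‖z s‖ < r) → z ∈ (presAt X hlog pp).latticeF (labelSucc i₀) 1)
    (hbdd : haveI : Fact (pp : ℕ).Prime := ⟨pp.2⟩
      ∀ z ∈ (presAt X hlog pp).latticeF (labelSucc i₀) 1, ∀ s, ‖z s‖ ≤ R)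
    (hΘ : haveI : Fact (pp : ℕ).Prime := ⟨pp.2⟩
      ∀ m : ℤ, ∀ z ∈ thetaBox m (thetaPilotObject sig split) (labelSucc i₀) (.inr pp),
        ∀ (e : (thetaIndex X).Caps (labelSucc i₀) → (thetaIndex X).Fibre (.inr pp))
          (i : DIdx pp.1 ((presAt X hlog pp).kk e)), ‖z ⟨e, i⟩‖ ≤ ρ e)
    (H : BridgeHyps (settingPrVol X hlog M archPk archSub Ψ act Mmod region n lat sig split qData thetaBox qCentre hq
      hfin)) :
    haveI : Fact (pp : ℕ).Prime := ⟨pp.2⟩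
    ((settingPrVol X hlog M archPk archSub Ψ act Mmod region n lat sig split qData thetaBox qCentre hq
        hfin).thetaLocal (labelSucc i₀) (.inr pp)).untopD 0 ≤
      Real.log (((pp : ℕ) : ℝ) ^ 2 * R / r) +
        ∑ e : (presAtPr X hlog pp).toLocalPieces.E (labelSucc i₀),
          (presAtPr X hlog pp).w (labelSucc i₀) e * Real.log (ρ e) := by
  haveI : Fact (pp : ℕ).Prime := ⟨pp.2⟩
  have hp0 : (0 : ℝ) < (pp : ℕ) := by exact_mod_cast (Fact.out : (pp : ℕ).Prime).pos
  refine (thetaLocal_settingPrVol_untopD_le_of_polydiscS X hlog M archPk archSub Ψ act Mmod region n lat sig split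
    qData thetaBox qCentre hq hfin pp i₀ hr hR ρ hρ hρsymm hball hbdd hΘ H).trans (le_of_eq ?_)
  have hsplit : ∀ e : (presAtPr X hlog pp).toLocalPieces.E (labelSucc i₀),
      (presAtPr X hlog pp).w (labelSucc i₀) e * Real.log (((pp : ℕ) : ℝ) ^ 2 * R * ρ e / r) =
        (presAtPr X hlog pp).w (labelSucc i₀) e * Real.log (((pp : ℕ) : ℝ) ^ 2 * R / r) +
          (presAtPr X hlog pp).w (labelSucc i₀) e * Real.log (ρ e) := fun e => by
    rw [← mul_add, show ((pp : ℕ) : ℝ) ^ 2 * R * ρ e / r = ((pp : ℕ) : ℝ) ^ 2 * R / r * ρ e by ring,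
      Real.log_mul (div_pos (mul_pos (pow_pos hp0 2) hR) hr).ne' (hρ e).ne']
  rw [Finset.sum_congr rfl fun e _ => hsplit e, Finset.sum_add_distrib, ← Finset.sum_mul, sum_w_presAtPr, one_mul]

end Generic

/-! ## §2. At `Real.settingPrVolSharp`: the (Ind1)-symmetrised Θ-gain `Σ_{v⃗} Pr(v⃗)·log max_a ‖t_{Θ,i+1,v_a}‖` is kept -/

section Sharp

variable (t : ∀ (pp : Nat.Primes) (_ : Fin X.lstar) (x : (thetaIndex X).Fibre (.inr pp)),
    haveI : Fact (pp : ℕ).Prime := ⟨pp.2⟩; kOf X pp.1 x)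
  (tq : ∀ (pp : Nat.Primes) (x : (thetaIndex X).Fibre (.inr pp)), haveI : Fact (pp : ℕ).Prime := ⟨pp.2⟩; kOf X pp.1 x)

/-- The tuple-wise radius `max_a ‖t_{Θ,i+1,v_a}‖` is capsule-symmetric ((Ind1) permutes the capsule index).
[cite: DupuyHilado2025, §4.7] -/
theorem sup'_norm_comp_perm (pp : Nat.Primes) (i₀ : Fin (thetaIndex X).lstar)
    (σ : Equiv.Perm ((thetaIndex X).Caps (labelSucc i₀)))
    (e : (thetaIndex X).Caps (labelSucc i₀) → (thetaIndex X).Fibre (.inr pp)) :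
    haveI : Fact (pp : ℕ).Prime := ⟨pp.2⟩
    (Finset.univ.sup' ⟨0, Finset.mem_univ _⟩ fun a => ‖t pp i₀ ((e ∘ ⇑σ) a)‖) =
      Finset.univ.sup' ⟨0, Finset.mem_univ _⟩ fun a => ‖t pp i₀ (e a)‖ := by
  haveI : Fact (pp : ℕ).Prime := ⟨pp.2⟩
  refine le_antisymm (Finset.sup'_le _ _ fun a _ => ?_) (Finset.sup'_le _ _ fun a _ => ?_)
  · exact Finset.le_sup' (fun b => ‖t pp i₀ (e b)‖) (Finset.mem_univ (σ a))
  · have h : ‖t pp i₀ (e a)‖ = ‖t pp i₀ ((e ∘ ⇑σ) (σ.symm a))‖ := by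
      rw [Function.comp_apply, Equiv.apply_symm_apply]
    rw [h]
    exact Finset.le_sup' (fun b => ‖t pp i₀ ((e ∘ ⇑σ) b)‖) (Finset.mem_univ (σ.symm a))

/-- **Per-TUPLE genuine-glue UPPER BOUND at `Real.settingPrVolSharp`** (pilot regions read off ideles `t`, `tq` —
non-zero, units off `S`; any prime, ramified included):
`−|log(Θ)|_{i+1,p} ≤ log(p²·R/r) + Σ_{v⃗} Pr(v⃗)·log max_a ‖t_{Θ,i+1,v_a}‖`. The sharp Θ-box at `(i+1, p)` is the
hull-set `λ_Θ·𝒪_L` with `‖λ_{Θ,(v⃗,i)}‖ = ‖t_{Θ,i+1,v_{i+1}}‖ ≤ max_a ‖t_{Θ,i+1,v_a}‖` (abc-iut-c312-3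
`thetaBoxDH_sharp_inr`, `norm_thetaCentre_sharp`), a capsule-symmetric tuple-wise radius, and `BridgeHyps` is
abc-iut-c312-7's theorem `bridgeHyps_settingPrVolSharp_of_ideles`; so §1 applies. For Θ-ideles REALISING `P_Θ`
(Dupuy–Hilado (3.4)) the kept term is `−Σ_{v⃗} Pr(v⃗)·min_a P_{Θ,i+1}(v_a)·ln|κ(v_a)|/n_{v_a}` — [IUTchIV] Thm. 1.10
Step (v)'s `min` over the tuple, non-zero exactly on the tuples all of whose places lie in `S`.
[claim: Mochizuki2012, status: disputed] [cite: DupuyHilado2025, §3.4, §3.9, §4.10] -/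
theorem thetaLocal_settingPrVolSharp_untopD_le (ht0 : ∀ pp i x, t pp i x ≠ 0)
    (ht1 : ∀ (pp : Nat.Primes) (i : Fin X.lstar) (x : (thetaIndex X).Fibre (.inr pp)),
      haveI : Fact (pp : ℕ).Prime := ⟨pp.2⟩; placeOf X pp.1 x ∉ X.S → ‖t pp i x‖ = 1)
    (htq0 : ∀ pp x, tq pp x ≠ 0)
    (htq1 : ∀ (pp : Nat.Primes) (x : (thetaIndex X).Fibre (.inr pp)),
      haveI : Fact (pp : ℕ).Prime := ⟨pp.2⟩; placeOf X pp.1 x ∉ X.S → ‖tq pp x‖ = 1)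
    (pp : Nat.Primes) (i₀ : Fin (thetaIndex X).lstar) {r R : ℝ} (hr : 0 < r) (hR : 0 < R)
    (hball : haveI : Fact (pp : ℕ).Prime := ⟨pp.2⟩
      ∀ z : (∀ s : (presAt X hlog pp).factorIdx (labelSucc i₀), (presAt X hlog pp).factorField (labelSucc i₀) s),
        (∀ s, ‖z s‖ < r) → z ∈ (presAt X hlog pp).latticeF (labelSucc i₀) 1)
    (hbdd : haveI : Fact (pp : ℕ).Prime := ⟨pp.2⟩
      ∀ z ∈ (presAt X hlog pp).latticeF (labelSucc i₀) 1, ∀ s, ‖z s‖ ≤ R) :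
    haveI : Fact (pp : ℕ).Prime := ⟨pp.2⟩
    ((settingPrVolSharp X hlog M archPk archSub Ψ act Mmod region n lat sig split qData tq t htq0
        htq1).thetaLocal (labelSucc i₀) (.inr pp)).untopD 0 ≤
      Real.log (((pp : ℕ) : ℝ) ^ 2 * R / r) +
        ∑ e : (presAtPr X hlog pp).toLocalPieces.E (labelSucc i₀),
          (presAtPr X hlog pp).w (labelSucc i₀) e *
            Real.log (Finset.univ.sup' ⟨0, Finset.mem_univ _⟩ fun a => ‖t pp i₀ (e a)‖) := by
  haveI : Fact (pp : ℕ).Prime := ⟨pp.2⟩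
  have hρ : ∀ e : (thetaIndex X).Caps (labelSucc i₀) → (thetaIndex X).Fibre (.inr pp),
      0 < Finset.univ.sup' ⟨0, Finset.mem_univ _⟩ fun a => ‖t pp i₀ (e a)‖ := fun e =>
    lt_of_lt_of_le (norm_pos_iff.mpr (ht0 pp i₀ (e 0)))
      (Finset.le_sup' (fun a => ‖t pp i₀ (e a)‖) (Finset.mem_univ 0))
  refine thetaLocal_settingPrVol_untopD_le_add_sum_log X hlog M archPk archSub Ψ act Mmod region n lat sig split qData
    (fun _ _ => thetaBoxDH X hlog (sharpBoxDH X hlog t)) (fun _ => qCentreDH X hlog tq) (qCentreDH_ne_zero X hlog tq htq0)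
    (finite_support_logvol_qRegion_Pr X hlog M archPk archSub Ψ act Mmod region n tq htq0 htq1) pp i₀ hr hR
    (fun e => Finset.univ.sup' ⟨0, Finset.mem_univ _⟩ fun a => ‖t pp i₀ (e a)‖) hρ
    (fun σ e => sup'_norm_comp_perm X t pp i₀ σ e) hball hbdd (fun m z hz e i => ?_)
    (bridgeHyps_settingPrVolSharp_of_ideles X hlog M archPk archSub Ψ act Mmod region n lat sig split qData t tq ht0 ht1
      htq0 htq1)
  -- the sharp box is the hull-set of the Θ-centre, whose `(v⃗, i)`-coordinate has norm `‖t_{Θ,i₀+1,v_{i₀+1}}‖`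
  have hz' : z ∈ hullSet ((presAt X hlog pp).factorField (labelSucc i₀)) ((presAt X hlog pp).centreOf fun e =>
      iota pp.1 ((presAt X hlog pp).kk e) (Fin.last _) (labelIdele X t pp (labelSucc i₀) (e (Fin.last _)))) := by
    rw [← thetaBoxDH_sharp_inr X hlog t ht0 (labelSucc i₀) pp]
    exact hz
  have hzs := (mem_polydisc (K := (presAt X hlog pp).factorField (labelSucc i₀))
    (x := fun s => z s)).1 hz'
  refine (hzs ⟨e, i⟩).trans ?_
  rw [norm_thetaCentre_sharp, labelIdele_labelSucc]
  exact Finset.le_sup' (fun a => ‖t pp i₀ (e a)‖) (Finset.mem_univ (Fin.last _))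

end Sharp

end Real

end Thm311

end IUTFork

end Summit.ABC

end
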